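import Summits.QuantumFields.BalabanUV.Beta.FP.PerfectSymbol166Pos

/-!
# `BalabanUV.Beta.FP.PerfectMaxwellSymbol` — road «FP» for binder row D1, leaf H2-P (coercivity core) of the horizontal route (owner ruling R-FP-15;
# `HOME/b2b-balaban-beta-d1-p3/H2-DESIGN.md` §5): the WEIGHTED MAXWELL QUADRATIC FORM of a plaquette-weight family — pure gauges are null, and positive
# two-sided weight bounds give two-sided comparison with the unweighted Maxwell form; instance: the continuum (1.66) weights `Re W_∞` on the real zone

HONEST DEPENDENCY (page 1, mandatory): continuum YM on T⁴ ⇐ BetaPertH ∧ nine spine estimates (0/9 proved); BetaPertH ⇐ (D1) ∧ (D4) ∧ CAP+tail;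
G-an2-4 gates asym, D1 and NE2/3/4.  HONEST FRAMING (cell contract, verbatim): «discharging `BetaPertH` makes Bałaban's UV stability UNCONDITIONAL —
a real constructive-QFT result; it is NOT the continuum limit and NOT the Clay problem.»  THIS MODULE DISCHARGES NOTHING of the wall: [folklore] algebra of
finite sums over `Fin d` (Mathlib) + ONE instantiation at the tree's `PerfectSymbol166Pos.W166Inf_ofReal_re_bounds` (p229611).  ONE data def (`maxwellQ`, the
weighted Maxwell form — [our object]); no `def … : Prop`; nothing cited as a hypothesis; 0 sorry; 0 wall binders; NOT D1, NOT BetaPertH, NOT continuum, NOT Clay.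

ABSOLUTE RULE (cell charter, verbatim): «No internally-minted statement may enter as a cited fact. Every hypothesis is either kernel-proved in this package or a
verbatim quotation of a PUBLISHED theorem with page reference. The manuscript(s) under audit are NOT citable for their own disputed steps — they are the thing
under adjudication; programme-internal (2001/route/tribunal) claims are never citable.»

WHAT.  For a weight family `W : Fin d → Fin d → ℝ` (plaquette orientations `(μ, ν)`), lattice momentum factors `ph : Fin d → ℂ` (on the road: `ph a = e^{ip_a} − 1`)
and a 1-form amplitude `v : Fin d → ℂ`, the WEIGHTED MAXWELL FORM is `maxwellQ W ph v := Σ_μ Σ_{ν ≠ μ} ½·W μ ν·‖ph μ · v ν − ph ν · v μ‖²` — the momentum-space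
quadratic form of a generalised Maxwell action whose `(μ,ν)`-plaquette carries the multiplier `W μ ν` (on the road: Bałaban's perfect effective Laplacian `Δ_∞`,
`EffectiveLaplacianLimit.deltaZLim`, whose entry symbols are `½·W_∞(μ,ν;p)·(e^{−ip_a} − 1)(e^{ip_b} − 1)`, `PerfectSymbolKMultiplierClosed.GsymInf`; the
identification of `maxwellQ (Re W_∞) ph` with the Fourier symbol of `deltaZLim` is the dictionary row H2-P-DICT, NOT in this file).
* §1 `maxwellQ_nonneg` (nonnegative weights), **`maxwellQ_pureGauge`** (`v = c • ph` ⟹ `0`: TRANSVERSALITY — lattice pure gauges are null for EVERY weight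
  family), **`maxwellQ_mono`** ∕ `maxwellQ_ge_of_le` ∕ `maxwellQ_le_of_le` (termwise comparison: `γ ≤ W ≤ Γ` off the diagonal ⟹ `γ·maxwellQ 1 ≤ maxwellQ W ≤ Γ·maxwellQ 1`,
  `1` = the constant-one family = the plain Maxwell form).
* §2 **`maxwellQ_W166Inf_bounds`**: at a real momentum `s` of the Brillouin zone, with `W := fun μ ν => Re W_∞(μ,ν; s)`:
  `(4/π²)^{d+2} · maxwellQ 1 ph v ≤ maxwellQ W ph v ≤ (π²/4)^{2d+4} · maxwellQ 1 ph v` for EVERY `ph`, `v` — the COERCIVITY (relative to plain Maxwell, hence on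
  transverse amplitudes) and BOUNDEDNESS of the perfect Laplacian's symbol: the invertibility input (P-i) of the unconstrained perfect propagator `(Δ* + slice)⁻¹` of
  road FP's analytic leaf (H2).  No estimate of Bałaban's kernels beyond the tree's `w166_bounds` (PROVED there) is used.
Provenance: road FP owner b2b-balaban-beta-d1-p3 gen 4 (prover-b2b-balaban-beta-d1-p3-g4-0), 2026-08-20.
-/

noncomputable section

namespace Summit.QuantumFields.BalabanUV.Beta.FP.PerfectMaxwellSymbol

open Finset
open scoped BigOperators
open Literature.MathematicalPhysics.QuantumFieldTheory.Balaban1983to89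
open B4Strip (ofRealVec)
open B4ContourShift (BZ)
open Summit.QuantumFields.BalabanUV.Beta.FP.PerfectSymbol166 (W166Inf)
open Summit.QuantumFields.BalabanUV.Beta.FP.PerfectSymbol166Pos (W166Inf_ofReal_re_bounds W166Inf_ofReal_re_lower)

variable {d : ℕ}

/-! ## §1 The weighted Maxwell form of a plaquette-weight family -/

/-- [our object] **THE WEIGHTED MAXWELL QUADRATIC FORM** `Σ_μ Σ_{ν ≠ μ} ½·W μ ν·‖ph μ · v ν − ph ν · v μ‖²` (ordered pairs; for a symmetric family this is
`Σ_{μ<ν} W μ ν ‖…‖²`). -/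
def maxwellQ (W : Fin d → Fin d → ℝ) (ph v : Fin d → ℂ) : ℝ :=
  ∑ μ, ∑ ν, if μ = ν then 0 else (1 / 2) * W μ ν * ‖ph μ * v ν - ph ν * v μ‖ ^ 2

/-- [folklore] The plaquette term is nonnegative for a nonnegative weight. -/
theorem term_nonneg {W : Fin d → Fin d → ℝ} (hW : ∀ μ ν, μ ≠ ν → 0 ≤ W μ ν) (ph v : Fin d → ℂ) (μ ν : Fin d) :
    0 ≤ (if μ = ν then 0 else (1 / 2) * W μ ν * ‖ph μ * v ν - ph ν * v μ‖ ^ 2 : ℝ) := by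
  split_ifs with h
  · exact le_rfl
  · exact mul_nonneg (mul_nonneg (by norm_num) (hW μ ν h)) (sq_nonneg _)

/-- [folklore] **NONNEGATIVITY** for nonnegative weights. -/
theorem maxwellQ_nonneg {W : Fin d → Fin d → ℝ} (hW : ∀ μ ν, μ ≠ ν → 0 ≤ W μ ν) (ph v : Fin d → ℂ) : 0 ≤ maxwellQ W ph v :=
  sum_nonneg fun μ _ => sum_nonneg fun ν _ => term_nonneg hW ph v μ ν

/-- [folklore] **TRANSVERSALITY: LATTICE PURE GAUGES ARE NULL** — for `v = c • ph` (the Fourier image of a lattice gradient `dλ`), every plaquette term vanishes,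
for EVERY weight family. -/
theorem maxwellQ_pureGauge (W : Fin d → Fin d → ℝ) (ph : Fin d → ℂ) (c : ℂ) : maxwellQ W ph (c • ph) = 0 := by
  unfold maxwellQ
  refine sum_eq_zero fun μ _ => sum_eq_zero fun ν _ => ?_
  split_ifs with h
  · rfl
  · have : ph μ * (c • ph) ν - ph ν * (c • ph) μ = 0 := by simp [Pi.smul_apply, smul_eq_mul]; ring
    rw [this, norm_zero]; ring

/-- [folklore] **TERMWISE MONOTONICITY IN THE WEIGHTS**: `W ≤ W′` off the diagonal ⟹ `maxwellQ W ≤ maxwellQ W′`. -/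
theorem maxwellQ_mono {W W' : Fin d → Fin d → ℝ} (h : ∀ μ ν, μ ≠ ν → W μ ν ≤ W' μ ν) (ph v : Fin d → ℂ) :
    maxwellQ W ph v ≤ maxwellQ W' ph v := by
  unfold maxwellQ
  refine sum_le_sum fun μ _ => sum_le_sum fun ν _ => ?_
  split_ifs with hμν
  · exact le_rfl
  · exact mul_le_mul_of_nonneg_right (mul_le_mul_of_nonneg_left (h μ ν hμν) (by norm_num)) (sq_nonneg _)

/-- [folklore] Scaling the weights scales the form: `maxwellQ (c·W) = c·maxwellQ W`. -/
theorem maxwellQ_smul (c : ℝ) (W : Fin d → Fin d → ℝ) (ph v : Fin d → ℂ) :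
    maxwellQ (fun μ ν => c * W μ ν) ph v = c * maxwellQ W ph v := by
  unfold maxwellQ
  rw [mul_sum]
  refine sum_congr rfl fun μ _ => ?_
  rw [mul_sum]
  refine sum_congr rfl fun ν _ => ?_
  split_ifs <;> ring

/-- [folklore] **LOWER COMPARISON WITH THE PLAIN MAXWELL FORM**: `γ ≤ W μ ν` for `μ ≠ ν` ⟹ `γ · maxwellQ 1 ph v ≤ maxwellQ W ph v` (`1` = the constant-one weights). -/
theorem maxwellQ_ge_of_le {W : Fin d → Fin d → ℝ} {γ : ℝ} (h : ∀ μ ν, μ ≠ ν → γ ≤ W μ ν) (ph v : Fin d → ℂ) :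
    γ * maxwellQ (fun _ _ => (1 : ℝ)) ph v ≤ maxwellQ W ph v := by
  have e : γ * maxwellQ (fun _ _ => (1 : ℝ)) ph v = maxwellQ (fun _ _ => γ * 1) ph v := (maxwellQ_smul γ _ ph v).symm
  rw [e]
  exact maxwellQ_mono (fun μ ν hμν => by rw [mul_one]; exact h μ ν hμν) ph v

/-- [folklore] **UPPER COMPARISON**: `W μ ν ≤ Γ` for `μ ≠ ν` ⟹ `maxwellQ W ph v ≤ Γ · maxwellQ 1 ph v`. -/
theorem maxwellQ_le_of_le {W : Fin d → Fin d → ℝ} {Γ : ℝ} (h : ∀ μ ν, μ ≠ ν → W μ ν ≤ Γ) (ph v : Fin d → ℂ) :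
    maxwellQ W ph v ≤ Γ * maxwellQ (fun _ _ => (1 : ℝ)) ph v := by
  have e : Γ * maxwellQ (fun _ _ => (1 : ℝ)) ph v = maxwellQ (fun _ _ => Γ * 1) ph v := (maxwellQ_smul Γ _ ph v).symm
  rw [e]
  exact maxwellQ_mono (fun μ ν hμν => by rw [mul_one]; exact h μ ν hμν) ph v

/-- [folklore] The plain Maxwell form is nonnegative. -/
theorem maxwellQ_one_nonneg (ph v : Fin d → ℂ) : 0 ≤ maxwellQ (fun _ _ => (1 : ℝ)) ph v :=
  maxwellQ_nonneg (fun _ _ _ => zero_le_one) ph v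

/-! ## §2 Instance: the continuum (1.66) weights on the real Brillouin zone -/

/-- [our object] **COERCIVITY AND BOUNDEDNESS OF THE PERFECT LAPLACIAN's WEIGHTED MAXWELL SYMBOL** (relative to plain Maxwell): at every real momentum `s` of the
Brillouin zone, with the weights `W μ ν := Re W_∞(μ,ν; s)` (`PerfectSymbol166.W166Inf`), for EVERY momentum-factor vector `ph` and amplitude `v`,
`(4/π²)^{d+2} · maxwellQ 1 ph v ≤ maxwellQ W ph v ≤ (π²/4)^{2d+4} · maxwellQ 1 ph v` (`PerfectSymbol166Pos.W166Inf_ofReal_re_bounds`/`_re_lower` off the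
diagonal; at `s = 0`: `W_∞ = 1` for the lower side, and the upper side there needs `s ≠ 0` only through `w166_bounds` — so the upper bound is stated on the
PUNCTURED zone and the lower bound on the whole zone). -/
theorem maxwellQ_W166Inf_lower {s : Fin d → ℝ} (hs : s ∈ BZ d) (ph v : Fin d → ℂ) :
    (4 / Real.pi ^ 2) ^ (d + 2) * maxwellQ (fun _ _ => (1 : ℝ)) ph v ≤ maxwellQ (fun μ ν => (W166Inf μ ν (ofRealVec s)).re) ph v :=
  maxwellQ_ge_of_le (fun _ _ hμν => W166Inf_ofReal_re_lower hμν hs) ph v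

/-- [our object] … the upper side on the punctured zone. -/
theorem maxwellQ_W166Inf_upper {s : Fin d → ℝ} (hs : s ∈ BZ d) (ν₀ : Fin d) (hν₀ : s ν₀ ≠ 0) (ph v : Fin d → ℂ) :
    maxwellQ (fun μ ν => (W166Inf μ ν (ofRealVec s)).re) ph v ≤ (Real.pi ^ 2 / 4) ^ (2 * d + 4) * maxwellQ (fun _ _ => (1 : ℝ)) ph v :=
  maxwellQ_le_of_le (fun _ _ hμν => (W166Inf_ofReal_re_bounds hμν hs ν₀ hν₀).2) ph v

/-- [our object] **THE TWO-SIDED COMPARISON** on the punctured real zone. -/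
theorem maxwellQ_W166Inf_bounds {s : Fin d → ℝ} (hs : s ∈ BZ d) (ν₀ : Fin d) (hν₀ : s ν₀ ≠ 0) (ph v : Fin d → ℂ) :
    (4 / Real.pi ^ 2) ^ (d + 2) * maxwellQ (fun _ _ => (1 : ℝ)) ph v ≤ maxwellQ (fun μ ν => (W166Inf μ ν (ofRealVec s)).re) ph v ∧
      maxwellQ (fun μ ν => (W166Inf μ ν (ofRealVec s)).re) ph v ≤ (Real.pi ^ 2 / 4) ^ (2 * d + 4) * maxwellQ (fun _ _ => (1 : ℝ)) ph v :=
  ⟨maxwellQ_W166Inf_lower hs ph v, maxwellQ_W166Inf_upper hs ν₀ hν₀ ph v⟩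

/-- [our object] In particular the perfect weighted form is NONNEGATIVE on the real zone and VANISHES on lattice pure gauges (positivity of the weights +
`maxwellQ_pureGauge`) — the perfect Laplacian's symbol is a nonnegative form with the pure gauges in its kernel, coercive on their complement exactly as much
as plain Maxwell is. -/
theorem maxwellQ_W166Inf_nonneg {s : Fin d → ℝ} (hs : s ∈ BZ d) (ph v : Fin d → ℂ) :
    0 ≤ maxwellQ (fun μ ν => (W166Inf μ ν (ofRealVec s)).re) ph v :=
  le_trans (mul_nonneg (by positivity) (maxwellQ_one_nonneg ph v)) (maxwellQ_W166Inf_lower hs ph v)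

end Summit.QuantumFields.BalabanUV.Beta.FP.PerfectMaxwellSymbol

end
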